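import Summits.QuantumFields.BalabanUV.Beta.GAN24.SecondOrderCarrierParity
import Summits.QuantumFields.BalabanUV.Beta.CombChartStepJets
import Summits.QuantumFields.BalabanUV.Beta.CombChartWardSockets
import Summits.QuantumFields.BalabanUV.Beta.SymmetrisedStepJetsParity
import Summits.QuantumFields.BalabanUV.Beta.SymTablesAn1FirstOrder
import Summits.QuantumFields.BalabanUV.Beta.SymSecondOrderTablesAn1

/-!
# `BalabanUV.Beta.GAN24.CombSecondOrderCarrierParity` — binder row G-an2-4 ∕ (CONV-C), W-slot, TRANSFER-III (the (α-0) chain at row D1's literal of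
# record (III′)): **LINK L5 — THE PARITY HALVES OF THE W-TABLES, SLOT-GENERIC AND FOR THE COMB CHART** — `GAN24/SecondOrderCarrierParity` §6
# (`evenHalf_WrecAt` ∕ `oddHalf_WrecAt`, stated at the (E) instance `WrecAt ρ` over `coDressKBmAt ρ (KInvStep j)` ∕ `SpureRecAt ρ` ∕ `M1At ρ`) RE-CUT ONCE
# OVER THE SLOTS `(G, S, M, vh₂S, mixFF)` of `SpineRooted.WrecOf`, then read at an2's comb-chart data `(GcombSh Lc, SpureCombOf tabs, tabs.M, tabs.vh₂S, tabs.mixFF)`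
# for ANY sym record `tabs : SymTables d Lc` with displayed table parities, and at an1's record `symTablesAn1S2 d Lc cΛ` with the parities DISCHARGED.

NOT IN PRINT; OUR BOOKKEEPING (G-an2-4 crux team (2), leaf prover `b2b-balaban-gan24-formalise-leaf-03`, gen 79; the OWNER gan24-p1 g46's (III′) LINK TABLE
R-gan24p1-g46-2, journal l.64934: «L5 carrier parity ∕ formula · `SecondOrderReadersParity` ∕ `SecondOrderCarrierParity` · leaf-03 · GENERIC in `(K, S, M)` with parity
hypotheses (by name at `GcombSh`, `SpureCombOf`, `tabs.M`)»; his INTENT-2 `CombEvenTowerAutonomy` l.64922 types L6 at (III′) and names as NOT done there «the carrier formula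
(L5 at the sym data)» — this file is that item, by the author of L5).  [folklore] composition BY NAME — 0 `def`, 0 cited facts, 0 `def … : Prop`, 0 sorry:
MY §3 `evenHalf_W2SymOfK` ∕ `oddHalf_W2SymOfK` (generic in `(K, S, M)`: decaying `K`, row-parity-odd `S`, `M`, entrywise bounded second-order tables) at the slot level with
an2's slot letters `SpineRooted.T2RecOf_loc` (⟸ (DG)(LS)(LM) + the binder letters `hB` `hmix`) and an1's `locStencilFM_M2Of`; at the comb chart with an2's
`CombChartStepJets.decays_GcombSh` ∕ `locStencil_SpureCombOf` ∕ the record's `hM hB hmix`, the pure members' parity from an2's slot-generic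
`SymmetrisedStepJetsParity.trK_SpureRecOf` at `G := GcombSh Lc` (sgn-symmetric: `CombChartWardSockets.trK_GcombSh`); at an1's record with
`SymTablesAn1FirstOrder.trK_symVhSAt` ∕ `trK_symHessFFAt` ∕ `trK_M1Of_symHessFFAt` (the OWNER's `CombEvenTowerAutonomy` §3 discharge, token for token).
HONEST FRAMING (cell contract, verbatim): «discharging `BetaPertH` makes Bałaban's UV stability UNCONDITIONAL — a real constructive-QFT result; it is NOT the continuum
limit and NOT the Clay problem.»  HONEST DEPENDENCY (verbatim): «continuum YM on T⁴ ⇐ BetaPertH ∧ nine spine estimates (0/9 proved); BetaPertH ⇐ (D1) ∧ (D4) ∧ CAP+tail;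
G-an2-4 gates asym, D1 and NE2/3/4.»

CONTENTS (`X^P := sgnK (trK X)`, `X^{ev∕od} := ½•(X ± X^P)` entrywise; generic `d`; `[NeZero Lc]`):
* §1 SLOTS — `evenHalf_WrecOf` ∕ `oddHalf_WrecOf`: for ANY slot data `G : ℕ → MKer`, `S M : ℕ → tables`, binders `vh₂S mixFF`, under the DISPLAYED letters (DG) `hG`, (LS) `hS`,
  (LM) `hM`, (LB) `hB`, (Lmix) `hmix` and the row parities (Sp) `hSp : ∀ j κ u, trK (S j κ u) = −sgnK (S j κ u)`, (Mp) `hMp`, every level `j` and slot pair: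
  `(WrecOf … j)^{ev} (μ,y;ν,y′) = W2SymOfK (G j) Lc (S j) (M j) (T2RecOf … j)^{ev} (M2Of mixFF j)^{ev} (μ,y;ν,y′) − ½•(dM (K2OfK … ν y′) … μ y + dM (K2OfK … μ y) … ν y′)`
  (NO second-response word on the even tables) and `(WrecOf … j)^{od} = W2SymOfK (G j) Lc (S j) (M j) (T2RecOf … j)^{od} (M2Of mixFF j)^{od}` (the FULL symmetrised
  carrier on the odd halves).  The (E) instance of §1 is `SecondOrderCarrierParity.evenHalf_WrecAt` ∕ `oddHalf_WrecAt` (tree, p351651-era; `SpineRooted.WrecOf_comb`) — not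
  restated.
* §2 COMB CHART — `evenHalf_WcombOf` ∕ `oddHalf_WcombOf`: §1 at `(GcombSh Lc, SpureCombOf tabs cE cVH cΛ, tabs.M, tabs.vh₂S, tabs.mixFF)` for ANY `tabs : SymTables d Lc`, the
  five letters supplied by the record and an2's comb-chart lemmas, under the DISPLAYED table parities (V-p) `hVp`, (H-p) `hHp`, (M-p) `hMp` (the OWNER's
  `CombEvenTowerAutonomy` §2 binders VERBATIM); `WcombOf tabs … j = WrecOf d Lc (GcombSh Lc) (SpureCombOf tabs …) tabs.M … j` by `rfl` (an2's `WcombOf_eq`).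
* §3 an1's RECORD — `evenHalf_WcombOf_an1` ∕ `oddHalf_WcombOf_an1`: §2 at `symTablesAn1S2 d Lc cΛt`, (V-p)(H-p)(M-p) DISCHARGED; NO hypothesis beyond `[NeZero Lc]`.
READING (zero weight): at (III′), as at (E), each parity half of the comb-chart W-table depends on the SAME half of the second-order tables `T̃′_j`, `M2Of tabs.mixFF j`
and on first-order ∕ letter data only — the carrier `W′` of the OWNER's `CombEvenTowerAutonomy.evenHalf_T2RecOf_comb_succ` in CLOSED FORM, and the comb twin of the
input `SecondOrderCarrierParity.evenHalf_WrecAt` of road-P2's L9 `WrecAtEvenHalfRows.unitW_evenHalf_WrecAt`.  WHAT THIS IS NOT: not one ROW of the W-slot (hW, hWall) at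
(III′), not the parity SPLIT of the comb-chart W-law (L3), not the T₂ shape ∕ drift ENDs (L8), not the junction (L7), not the value ledger (L10); the (III′) campaign is NOT
asked (an2 W-4 l.64553) — a zero-weight theorem over OUR typed objects; asserts NO value of Bałaban's tables; NEVER «G-an2-4 closed» as (CONV-C); NOT D1, NOT
`BetaPertH`, NOT continuum, NOT Clay.  Unit `b2b-balaban-gan24-formalise-leaf-03` (gen 79), 2026-08-25; no existing file touched.
-/

noncomputable section

open Finset
open scoped BigOperators
open Literature.MathematicalPhysics.QuantumFieldTheory
open Literature.MathematicalPhysics.QuantumFieldTheory.Balaban1983to89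
open Literature.MathematicalPhysics.QuantumFieldTheory.Balaban1983to89.Beta
open ExpKernelCalculus (MKer Decays VertexFamily)
open OneStepResolventKernel (Fib LocStencil)
open BalabanCompositeJets (LocStencil₂)
open SecondOrderResponse (dM K2OfK W2SymOfK LocStencilFM)
open BalabanStepW2 (M2Of locStencilFM_M2Of)
open AveragingContoursRooted (ctr)
open Summit.QuantumFields.BalabanUV.Beta.TameKernelCalculus
open Summit.QuantumFields.BalabanUV.Beta.BorderedHessian (sgnK)
open Summit.QuantumFields.BalabanUV.Beta.AxialDressingRooted (one_le_of_neZero)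
open Summit.QuantumFields.BalabanUV.Beta.SpineRooted (T2RecOf WrecOf WrecOf_eq T2RecOf_loc)
open Summit.QuantumFields.BalabanUV.Beta.SecondOrderRemainderTables (abs_le_of_locStencil₂ abs_le_of_locStencilFM)
open Summit.QuantumFields.BalabanUV.Beta.SymmetrisedStepJets (SymTables)
open Summit.QuantumFields.BalabanUV.Beta.SymmetrisedStepJetsParity (trK_SpureRecOf)
open Summit.QuantumFields.BalabanUV.Beta.CombChartStepJets (GcombSh decays_GcombSh SpureCombOf SpureCombOf_eq locStencil_SpureCombOf WcombOf WcombOf_eq)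
open Summit.QuantumFields.BalabanUV.Beta.CombChartWardSockets (trK_GcombSh)
open Summit.QuantumFields.BalabanUV.Beta.SymTablesAn1FirstOrder (trK_symVhSAt trK_symHessFFAt trK_M1Of_symHessFFAt)
open Summit.QuantumFields.BalabanUV.Beta.SymSecondOrderTablesAn1 (symTablesAn1S2)
open Summit.QuantumFields.BalabanUV.Beta.GAN24.SecondOrderCarrierParity (evenHalf_W2SymOfK oddHalf_W2SymOfK)

namespace Summit.QuantumFields.BalabanUV.Beta.GAN24.CombSecondOrderCarrierParity

variable {d : ℕ} {Lc : ℕ} [NeZero Lc]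

/-! ## §1 The slots: the parity halves of `WrecOf G S M … j` under the displayed letters and row parities -/

section Slot

variable {G : ℕ → MKer (d + 1) (Fib d)} {S M : ℕ → Fin (d + 1) → (Fin (d + 1) → ℤ) → MKer (d + 1) (Fib d)} (cE₂ cB : ℝ)
  (T : Fin 4 → Fin 4 → Fin 4 → Fin 4 → ℝ)
  (vh₂S mixFF : Fin (d + 1) → (Fin (d + 1) → ℤ) → Fin (d + 1) → (Fin (d + 1) → ℤ) → MKer (d + 1) (Fib d))

/-- [folklore] **LINK L5 OVER THE SLOTS — THE EVEN HALF OF `WrecOf G S M … j` IS THE SYMMETRISED CARRIER OVER `G j` ON THE EVEN HALVES OF `T2RecOf … j` AND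
`M2Of mixFF j`, MINUS ITS SYMMETRISED SECOND-RESPONSE WORD** (generic `d`, `Lc ≥ 1`, every level `j`, every slot pair; DISPLAYED: (DG) `hG`, (LS) `hS`, (LM) `hM`,
(LB) `hB`, (Lmix) `hmix` — which give the entrywise bounds through an2's `T2RecOf_loc` and an1's `locStencilFM_M2Of` — and the row parities (Sp) `hSp`, (Mp) `hMp`):
`GAN24/SecondOrderCarrierParity` §3 `evenHalf_W2SymOfK` at `K := G j`, `S := S j`, `M := M j` (`WrecOf_eq`).  The (E) instance is `SecondOrderCarrierParity.evenHalf_WrecAt`. -/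
theorem evenHalf_WrecOf (hLc : 1 ≤ Lc) (hG : ∀ j : ℕ, ∃ δ C : ℝ, 0 < δ ∧ 0 ≤ C ∧ Decays (G j) C δ)
    (hS : ∀ j : ℕ, ∃ Cs δ : ℝ, 0 < δ ∧ LocStencil (S j) Cs δ) (hM : ∀ j : ℕ, ∃ CM δ : ℝ, 0 < δ ∧ VertexFamily (M j) Lc CM δ)
    (hB : ∃ C δ : ℝ, 0 < δ ∧ LocStencil₂ vh₂S C δ) (hmix : ∃ C δ : ℝ, 0 < δ ∧ LocStencilFM Lc mixFF C δ)
    (hSp : ∀ (j : ℕ) (κ : Fin (d + 1)) (u : Fin (d + 1) → ℤ), trK (S j κ u) = -sgnK (S j κ u))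
    (hMp : ∀ (j : ℕ) (ρ : Fin (d + 1)) (w : Fin (d + 1) → ℤ), trK (M j ρ w) = -sgnK (M j ρ w))
    (j : ℕ) (μ : Fin (d + 1)) (y : Fin (d + 1) → ℤ) (ν : Fin (d + 1)) (y' : Fin (d + 1) → ℤ) :
    (1 / 2 : ℝ) • (WrecOf d Lc G S M cE₂ cB T vh₂S mixFF j μ y ν y' + sgnK (trK (WrecOf d Lc G S M cE₂ cB T vh₂S mixFF j μ y ν y'))) =
      W2SymOfK (G j) Lc (S j) (M j)
          (fun κ u κ' u' => (1 / 2 : ℝ) • (T2RecOf d Lc G S M cE₂ cB T vh₂S mixFF j κ u κ' u'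
            + sgnK (trK (T2RecOf d Lc G S M cE₂ cB T vh₂S mixFF j κ u κ' u'))))
          (fun κ u ρ w => (1 / 2 : ℝ) • (M2Of d Lc mixFF j κ u ρ w + sgnK (trK (M2Of d Lc mixFF j κ u ρ w)))) μ y ν y'
        - (1 / 2 : ℝ) • (dM (K2OfK (G j) Lc (S j) (M j) ν y') Lc (S j) (M j) μ y + dM (K2OfK (G j) Lc (S j) (M j) μ y) Lc (S j) (M j) ν y') := by
  obtain ⟨C₂, δ₂, hδ₂, hT₂⟩ := T2RecOf_loc cE₂ cB T vh₂S mixFF hLc hG hS hM hB hmix j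
  obtain ⟨CM, δM, hδM, hM₂⟩ := hmix
  rw [WrecOf_eq]
  exact evenHalf_W2SymOfK (N := Lc) (hG j) (hSp j) (hMp j) (fun κ u κ' u' x z a b => abs_le_of_locStencil₂ hT₂ hδ₂.le κ u κ' u' x z a b)
    (fun κ u ρ' w x z a b => abs_le_of_locStencilFM (locStencilFM_M2Of hM₂ j) hδM.le κ u ρ' w x z a b) μ y ν y'

/-- [folklore] **LINK L5 OVER THE SLOTS — THE ODD HALF OF `WrecOf G S M … j` IS THE FULL SYMMETRISED CARRIER OVER `G j` ON THE ODD HALVES OF `T2RecOf … j` AND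
`M2Of mixFF j`** (the second-response word lives entirely in the odd half; same displayed letters and parities): §3 `oddHalf_W2SymOfK` at the slots.  The (E) instance is
`SecondOrderCarrierParity.oddHalf_WrecAt`. -/
theorem oddHalf_WrecOf (hLc : 1 ≤ Lc) (hG : ∀ j : ℕ, ∃ δ C : ℝ, 0 < δ ∧ 0 ≤ C ∧ Decays (G j) C δ)
    (hS : ∀ j : ℕ, ∃ Cs δ : ℝ, 0 < δ ∧ LocStencil (S j) Cs δ) (hM : ∀ j : ℕ, ∃ CM δ : ℝ, 0 < δ ∧ VertexFamily (M j) Lc CM δ)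
    (hB : ∃ C δ : ℝ, 0 < δ ∧ LocStencil₂ vh₂S C δ) (hmix : ∃ C δ : ℝ, 0 < δ ∧ LocStencilFM Lc mixFF C δ)
    (hSp : ∀ (j : ℕ) (κ : Fin (d + 1)) (u : Fin (d + 1) → ℤ), trK (S j κ u) = -sgnK (S j κ u))
    (hMp : ∀ (j : ℕ) (ρ : Fin (d + 1)) (w : Fin (d + 1) → ℤ), trK (M j ρ w) = -sgnK (M j ρ w))
    (j : ℕ) (μ : Fin (d + 1)) (y : Fin (d + 1) → ℤ) (ν : Fin (d + 1)) (y' : Fin (d + 1) → ℤ) :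
    (1 / 2 : ℝ) • (WrecOf d Lc G S M cE₂ cB T vh₂S mixFF j μ y ν y' - sgnK (trK (WrecOf d Lc G S M cE₂ cB T vh₂S mixFF j μ y ν y'))) =
      W2SymOfK (G j) Lc (S j) (M j)
        (fun κ u κ' u' => (1 / 2 : ℝ) • (T2RecOf d Lc G S M cE₂ cB T vh₂S mixFF j κ u κ' u'
          - sgnK (trK (T2RecOf d Lc G S M cE₂ cB T vh₂S mixFF j κ u κ' u'))))
        (fun κ u ρ w => (1 / 2 : ℝ) • (M2Of d Lc mixFF j κ u ρ w - sgnK (trK (M2Of d Lc mixFF j κ u ρ w)))) μ y ν y' := by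
  obtain ⟨C₂, δ₂, hδ₂, hT₂⟩ := T2RecOf_loc cE₂ cB T vh₂S mixFF hLc hG hS hM hB hmix j
  obtain ⟨CM, δM, hδM, hM₂⟩ := hmix
  rw [WrecOf_eq]
  exact oddHalf_W2SymOfK (N := Lc) (hG j) (hSp j) (hMp j) (fun κ u κ' u' x z a b => abs_le_of_locStencil₂ hT₂ hδ₂.le κ u κ' u' x z a b)
    (fun κ u ρ' w x z a b => abs_le_of_locStencilFM (locStencilFM_M2Of hM₂ j) hδM.le κ u ρ' w x z a b) μ y ν y'

end Slot

/-! ## §2 The comb chart: any sym record `tabs`, table parities (V-p)(H-p)(M-p) displayed -/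

section Comb

variable (tabs : SymTables d Lc) (cE cVH cΛ cE₂ cB : ℝ) (T : Fin 4 → Fin 4 → Fin 4 → Fin 4 → ℝ)

/-- [folklore] **LINK L5 AT (III′) — THE EVEN HALF OF THE COMB-CHART W-TABLE `WcombOf tabs … j` IS THE SYMMETRISED CARRIER OVER `GcombSh Lc j` ON THE EVEN HALVES OF
`T̃′_j := T2RecOf d Lc (GcombSh Lc) (SpureCombOf tabs …) tabs.M … j` AND `M2Of tabs.mixFF j`, MINUS ITS SYMMETRISED SECOND-RESPONSE WORD** (ANY `tabs : SymTables d Lc`, all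
pins, every level and slot pair; DISPLAYED: the table parities (V-p) `hVp`, (H-p) `hHp`, (M-p) `hMp` — the OWNER's `CombEvenTowerAutonomy` §2 binders verbatim): §1 with
the record's letters `hM hB hmix`, an2's `decays_GcombSh` ∕ `locStencil_SpureCombOf`, and (Sp) for the pure members from an2's slot-generic `trK_SpureRecOf` at
`G := GcombSh Lc` (`trK_GcombSh`).  This is the carrier `W′` of the OWNER's comb autonomy step in closed form. -/
theorem evenHalf_WcombOf
    (hVp : ∀ (κ : Fin (d + 1)) (u : Fin (d + 1) → ℤ), trK (tabs.V κ u) = -sgnK (tabs.V κ u))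
    (hHp : ∀ (μ : Fin (d + 1)) (y : Fin (d + 1) → ℤ), trK (tabs.H μ y) = -sgnK (tabs.H μ y))
    (hMp : ∀ (j : ℕ) (ρ : Fin (d + 1)) (w : Fin (d + 1) → ℤ), trK (tabs.M j ρ w) = -sgnK (tabs.M j ρ w))
    (j : ℕ) (μ : Fin (d + 1)) (y : Fin (d + 1) → ℤ) (ν : Fin (d + 1)) (y' : Fin (d + 1) → ℤ) :
    (1 / 2 : ℝ) • (WcombOf tabs cE cVH cΛ cE₂ cB T j μ y ν y' + sgnK (trK (WcombOf tabs cE cVH cΛ cE₂ cB T j μ y ν y'))) =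
      W2SymOfK (GcombSh (d := d) Lc j) Lc (SpureCombOf tabs cE cVH cΛ j) (tabs.M j)
          (fun κ u κ' u' => (1 / 2 : ℝ) • (T2RecOf d Lc (GcombSh Lc) (SpureCombOf tabs cE cVH cΛ) tabs.M cE₂ cB T tabs.vh₂S tabs.mixFF j κ u κ' u'
            + sgnK (trK (T2RecOf d Lc (GcombSh Lc) (SpureCombOf tabs cE cVH cΛ) tabs.M cE₂ cB T tabs.vh₂S tabs.mixFF j κ u κ' u'))))
          (fun κ u ρ w => (1 / 2 : ℝ) • (M2Of d Lc tabs.mixFF j κ u ρ w + sgnK (trK (M2Of d Lc tabs.mixFF j κ u ρ w)))) μ y ν y'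
        - (1 / 2 : ℝ) • (dM (K2OfK (GcombSh (d := d) Lc j) Lc (SpureCombOf tabs cE cVH cΛ j) (tabs.M j) ν y') Lc (SpureCombOf tabs cE cVH cΛ j) (tabs.M j) μ y
            + dM (K2OfK (GcombSh (d := d) Lc j) Lc (SpureCombOf tabs cE cVH cΛ j) (tabs.M j) μ y) Lc (SpureCombOf tabs cE cVH cΛ j) (tabs.M j) ν y') := by
  have hSp : ∀ (j : ℕ) (κ : Fin (d + 1)) (u : Fin (d + 1) → ℤ),
      trK (SpureCombOf tabs cE cVH cΛ j κ u) = -sgnK (SpureCombOf tabs cE cVH cΛ j κ u) := fun j κ u => by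
    rw [SpureCombOf_eq]
    exact trK_SpureRecOf tabs.hV tabs.hH (decays_GcombSh (d := d) Lc) (fun j => trK_GcombSh (d := d) (Lc := Lc) j) hVp hHp cE cVH cΛ j κ u
  rw [WcombOf_eq, ← SpureCombOf_eq]
  exact evenHalf_WrecOf (G := GcombSh Lc) (S := SpureCombOf tabs cE cVH cΛ) (M := tabs.M) cE₂ cB T tabs.vh₂S tabs.mixFF (one_le_of_neZero Lc)
    (decays_GcombSh (d := d) Lc) (locStencil_SpureCombOf tabs cE cVH cΛ) tabs.hM tabs.hB tabs.hmix hSp hMp j μ y ν y'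

/-- [folklore] **LINK L5 AT (III′) — THE ODD HALF OF THE COMB-CHART W-TABLE IS THE FULL SYMMETRISED CARRIER OVER `GcombSh Lc j` ON THE ODD HALVES OF `T̃′_j` AND
`M2Of tabs.mixFF j`** (same displayed table parities). -/
theorem oddHalf_WcombOf
    (hVp : ∀ (κ : Fin (d + 1)) (u : Fin (d + 1) → ℤ), trK (tabs.V κ u) = -sgnK (tabs.V κ u))
    (hHp : ∀ (μ : Fin (d + 1)) (y : Fin (d + 1) → ℤ), trK (tabs.H μ y) = -sgnK (tabs.H μ y))
    (hMp : ∀ (j : ℕ) (ρ : Fin (d + 1)) (w : Fin (d + 1) → ℤ), trK (tabs.M j ρ w) = -sgnK (tabs.M j ρ w))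
    (j : ℕ) (μ : Fin (d + 1)) (y : Fin (d + 1) → ℤ) (ν : Fin (d + 1)) (y' : Fin (d + 1) → ℤ) :
    (1 / 2 : ℝ) • (WcombOf tabs cE cVH cΛ cE₂ cB T j μ y ν y' - sgnK (trK (WcombOf tabs cE cVH cΛ cE₂ cB T j μ y ν y'))) =
      W2SymOfK (GcombSh (d := d) Lc j) Lc (SpureCombOf tabs cE cVH cΛ j) (tabs.M j)
        (fun κ u κ' u' => (1 / 2 : ℝ) • (T2RecOf d Lc (GcombSh Lc) (SpureCombOf tabs cE cVH cΛ) tabs.M cE₂ cB T tabs.vh₂S tabs.mixFF j κ u κ' u'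
          - sgnK (trK (T2RecOf d Lc (GcombSh Lc) (SpureCombOf tabs cE cVH cΛ) tabs.M cE₂ cB T tabs.vh₂S tabs.mixFF j κ u κ' u'))))
        (fun κ u ρ w => (1 / 2 : ℝ) • (M2Of d Lc tabs.mixFF j κ u ρ w - sgnK (trK (M2Of d Lc tabs.mixFF j κ u ρ w)))) μ y ν y' := by
  have hSp : ∀ (j : ℕ) (κ : Fin (d + 1)) (u : Fin (d + 1) → ℤ),
      trK (SpureCombOf tabs cE cVH cΛ j κ u) = -sgnK (SpureCombOf tabs cE cVH cΛ j κ u) := fun j κ u => by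
    rw [SpureCombOf_eq]
    exact trK_SpureRecOf tabs.hV tabs.hH (decays_GcombSh (d := d) Lc) (fun j => trK_GcombSh (d := d) (Lc := Lc) j) hVp hHp cE cVH cΛ j κ u
  rw [WcombOf_eq, ← SpureCombOf_eq]
  exact oddHalf_WrecOf (G := GcombSh Lc) (S := SpureCombOf tabs cE cVH cΛ) (M := tabs.M) cE₂ cB T tabs.vh₂S tabs.mixFF (one_le_of_neZero Lc)
    (decays_GcombSh (d := d) Lc) (locStencil_SpureCombOf tabs cE cVH cΛ) tabs.hM tabs.hB tabs.hmix hSp hMp j μ y ν y'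

end Comb

/-! ## §3 an1's record `symTablesAn1S2 d Lc cΛt`: the three table parities discharged -/

section An1

variable (cΛt cE cVH cΛ cE₂ cB : ℝ) (T : Fin 4 → Fin 4 → Fin 4 → Fin 4 → ℝ)

/-- [folklore] **LINK L5 AT (III′) FOR an1's RECORD, UNCONDITIONAL — THE EVEN HALF OF `WcombOf (symTablesAn1S2 d Lc cΛt) … j`**: §2 with (V-p)(H-p)(M-p) DISCHARGED
by an1's `SymTablesAn1FirstOrder.trK_symVhSAt` ∕ `trK_symHessFFAt` ∕ `trK_M1Of_symHessFFAt` (the record's slots are `symVhSAt ρ_c`, `symHessFFAt ρ_c`,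
`M1Of d Lc (symHessFFAt ρ_c Lc) cΛt` by `rfl`).  NO hypothesis beyond `[NeZero Lc]`. -/
theorem evenHalf_WcombOf_an1 (j : ℕ) (μ : Fin (d + 1)) (y : Fin (d + 1) → ℤ) (ν : Fin (d + 1)) (y' : Fin (d + 1) → ℤ) :
    (1 / 2 : ℝ) • (WcombOf (symTablesAn1S2 d Lc cΛt) cE cVH cΛ cE₂ cB T j μ y ν y'
        + sgnK (trK (WcombOf (symTablesAn1S2 d Lc cΛt) cE cVH cΛ cE₂ cB T j μ y ν y'))) =
      W2SymOfK (GcombSh (d := d) Lc j) Lc (SpureCombOf (symTablesAn1S2 d Lc cΛt) cE cVH cΛ j) ((symTablesAn1S2 d Lc cΛt).M j)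
          (fun κ u κ' u' => (1 / 2 : ℝ) • (T2RecOf d Lc (GcombSh Lc) (SpureCombOf (symTablesAn1S2 d Lc cΛt) cE cVH cΛ) (symTablesAn1S2 d Lc cΛt).M cE₂ cB T
              (symTablesAn1S2 d Lc cΛt).vh₂S (symTablesAn1S2 d Lc cΛt).mixFF j κ u κ' u'
            + sgnK (trK (T2RecOf d Lc (GcombSh Lc) (SpureCombOf (symTablesAn1S2 d Lc cΛt) cE cVH cΛ) (symTablesAn1S2 d Lc cΛt).M cE₂ cB T
              (symTablesAn1S2 d Lc cΛt).vh₂S (symTablesAn1S2 d Lc cΛt).mixFF j κ u κ' u'))))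
          (fun κ u ρ w => (1 / 2 : ℝ) • (M2Of d Lc (symTablesAn1S2 d Lc cΛt).mixFF j κ u ρ w
            + sgnK (trK (M2Of d Lc (symTablesAn1S2 d Lc cΛt).mixFF j κ u ρ w)))) μ y ν y'
        - (1 / 2 : ℝ) • (dM (K2OfK (GcombSh (d := d) Lc j) Lc (SpureCombOf (symTablesAn1S2 d Lc cΛt) cE cVH cΛ j) ((symTablesAn1S2 d Lc cΛt).M j) ν y') Lc
              (SpureCombOf (symTablesAn1S2 d Lc cΛt) cE cVH cΛ j) ((symTablesAn1S2 d Lc cΛt).M j) μ y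
            + dM (K2OfK (GcombSh (d := d) Lc j) Lc (SpureCombOf (symTablesAn1S2 d Lc cΛt) cE cVH cΛ j) ((symTablesAn1S2 d Lc cΛt).M j) μ y) Lc
              (SpureCombOf (symTablesAn1S2 d Lc cΛt) cE cVH cΛ j) ((symTablesAn1S2 d Lc cΛt).M j) ν y') :=
  evenHalf_WcombOf (symTablesAn1S2 d Lc cΛt) cE cVH cΛ cE₂ cB T (fun κ u => trK_symVhSAt (ctr (d + 1) Lc) Lc κ u)
    (fun μ y => trK_symHessFFAt (ctr (d + 1) Lc) Lc μ y) (fun j ρ w => trK_M1Of_symHessFFAt (ctr (d + 1) Lc) cΛt j ρ w) j μ y ν y'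

/-- [folklore] **LINK L5 AT (III′) FOR an1's RECORD, UNCONDITIONAL — THE ODD HALF OF `WcombOf (symTablesAn1S2 d Lc cΛt) … j`** (§2, parities discharged). -/
theorem oddHalf_WcombOf_an1 (j : ℕ) (μ : Fin (d + 1)) (y : Fin (d + 1) → ℤ) (ν : Fin (d + 1)) (y' : Fin (d + 1) → ℤ) :
    (1 / 2 : ℝ) • (WcombOf (symTablesAn1S2 d Lc cΛt) cE cVH cΛ cE₂ cB T j μ y ν y'
        - sgnK (trK (WcombOf (symTablesAn1S2 d Lc cΛt) cE cVH cΛ cE₂ cB T j μ y ν y'))) =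
      W2SymOfK (GcombSh (d := d) Lc j) Lc (SpureCombOf (symTablesAn1S2 d Lc cΛt) cE cVH cΛ j) ((symTablesAn1S2 d Lc cΛt).M j)
        (fun κ u κ' u' => (1 / 2 : ℝ) • (T2RecOf d Lc (GcombSh Lc) (SpureCombOf (symTablesAn1S2 d Lc cΛt) cE cVH cΛ) (symTablesAn1S2 d Lc cΛt).M cE₂ cB T
            (symTablesAn1S2 d Lc cΛt).vh₂S (symTablesAn1S2 d Lc cΛt).mixFF j κ u κ' u'
          - sgnK (trK (T2RecOf d Lc (GcombSh Lc) (SpureCombOf (symTablesAn1S2 d Lc cΛt) cE cVH cΛ) (symTablesAn1S2 d Lc cΛt).M cE₂ cB T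
            (symTablesAn1S2 d Lc cΛt).vh₂S (symTablesAn1S2 d Lc cΛt).mixFF j κ u κ' u'))))
        (fun κ u ρ w => (1 / 2 : ℝ) • (M2Of d Lc (symTablesAn1S2 d Lc cΛt).mixFF j κ u ρ w
          - sgnK (trK (M2Of d Lc (symTablesAn1S2 d Lc cΛt).mixFF j κ u ρ w)))) μ y ν y' :=
  oddHalf_WcombOf (symTablesAn1S2 d Lc cΛt) cE cVH cΛ cE₂ cB T (fun κ u => trK_symVhSAt (ctr (d + 1) Lc) Lc κ u)
    (fun μ y => trK_symHessFFAt (ctr (d + 1) Lc) Lc μ y) (fun j ρ w => trK_M1Of_symHessFFAt (ctr (d + 1) Lc) cΛt j ρ w) j μ y ν y'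

end An1

end Summit.QuantumFields.BalabanUV.Beta.GAN24.CombSecondOrderCarrierParity

end
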